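import Literature.AnabelianGeometry.AbsoluteAnabelian.AbsTopIII.LogObservableLevels
import Literature.AnabelianGeometry.AbsoluteAnabelian.AbsTopIII.AutHolLogFrobeniusDescent
import HarnessLib

/-!
# [AbsTopIII] Corollary 4.5 (iii) over the abstract data: the observable `𝔖_log` constructed

Mochizuki, *Topics in Absolute Anabelian Geometry III*, Corollary 4.5 (iii) pp. 108–109 and its
proof pp. 109–110 (bib key `MochizukiAbsTopIII2015`; lit key `paper:url-5493eb38cbb7`, kurims
manuscript pages):
"The natural transformations `ι_log,⋎ : λ^× ∘ id_⋎ ∘ log → λ^∼ ∘ id_{⋎+1}`, `ι_× : λ^∼ → λ^×` belong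
to
a family of homotopies on `𝒟_{≤3}` that determines on `𝒟_{≤3}` a structure of observable `𝔖_log` on
`𝒟_{≤2}`".  For EVERY input datum `Δ : LogFrobeniusData` of Aut-holomorphic type (`Δ.ιtimes = inr
ι`)
this file CONSTRUCTS that family (`sLogFamily`: boundary set `SLogRel` = the saturation of the
printed
generators, homotopies `sLogEta` = the descent composites of `ι_×`, `ι_log,⋎`, transported to t2's
`HomotopyFamily` by t12's `HomotopyFamily.mkOfStrict`) and PROVES seat abc-iut-L4-t5's pinned
statement
`LogFrobeniusData.ObservableLogStmt` (`AbsTopIII/FrobeniusPictureMLF.lean`):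
`observableLogStmt_of_inr`
— i.e. `Cor_4_5_iii` of `AutHolLogFrobenius.lean` is DISCHARGED over the abstract archimedean data
(block W2-B4, node `AbsTopIII:Cor4.5(iii)`, seat abc-iut-L4-t10).  Not here: the compatibility of
`𝔖_log` with the core/telecore families (not typed by `ObservableLogStmt` either), the `§3`
orientation (Cor. 3.6 (iii): a different, finite boundary set — Rmk. 4.5.2).
-/

namespace Literature.AnabelianGeometry.AbsoluteAnabelian.AbsTopIII

open _root_.CategoryTheory _root_.Quiver LogFrobeniusData

universe u

section Family

variable (Δ : LogFrobeniusData.{u}) (ι : Δ.lamPf ⟶ Δ.lamTimes)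

/-- The homotopies of the strict family: descend `level p − level q` steps and identify the end
with `q` (uniqueness of paths of given level).
[cite: MochizukiAbsTopIII2015, Corollary 4.5 (iii) p.109] -/
noncomputable def sLogEta {a b : V3.{u}} {p q : Path a b} (h : SLogRel p q) :
    Δ.sub3.pathFunctor' p ⟶ Δ.sub3.pathFunctor' q :=
  descend Δ ι (level p - level q) p ≫
    eqToHom (congrArg Δ.sub3.pathFunctor'
      (iter_lower_eq' h.1 h.2.1 (level p - level q) p q (by have := h.2.2; omega)))

/-- Def. 3.5 (ii): the homotopy of a pair `([γ],[γ])` is the identity. [cite: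
MochizukiAbsTopIII2015, Corollary 4.5 (iii) p.109] -/
theorem sLogEta_refl {a b : V3.{u}} {p : Path a b} (h : SLogRel p p) : sLogEta Δ ι h = 𝟙 _ := by
  unfold sLogEta
  rw [descend_congr_nat Δ ι (Nat.sub_self (level p)) p]
  simp [descend_zero]

/-- Def. 3.5 (ii): homotopies compose along `E_log`. [cite: MochizukiAbsTopIII2015, Corollary 4.5
(iii) p.109] -/
theorem sLogEta_trans {a b : V3.{u}} {p q r : Path a b} (h₁ : SLogRel p q) (h₂ : SLogRel q r) :
    sLogEta Δ ι (isSaturated_sLogRel.trans h₁ h₂) = sLogEta Δ ι h₁ ≫ sLogEta Δ ι h₂ := by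
  have hq := iter_lower_eq' h₁.1 h₁.2.1 (level p - level q) p q (by have := h₁.2.2; omega)
  unfold sLogEta
  rw [descend_congr Δ ι (level q - level r) hq.symm,
    descend_congr_nat Δ ι (show level p - level r = (level q - level r) + (level p - level q) by
      have := h₁.2.2; have := h₂.2.2; omega) p,
    descend_add]
  simp

/-! ### Compatibility of `lower`, `step`, `descend` with pre-composition -/

/-- Whiskering along equal functors. [folklore] -/
private theorem whiskerLeft_congr_left {C₁ : Type*} [Category C₁] {C₂ : Type*} [Category C₂]
    {C₃ : Type*} [Category C₃] {F F' : C₁ ⥤ C₂} (hF : F = F') {G H : C₂ ⥤ C₃} (α : G ⟶ H) :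
    Functor.whiskerLeft F α = eqToHom (by rw [hF]) ≫ Functor.whiskerLeft F' α ≫ eqToHom (by rw [hF])
:= by
  subst hF; simp

/-- The step homotopy of a pre-composed path is the whiskered step homotopy (Def. 3.5 (ii) (b),
third condition, for the generators). [cite: MochizukiAbsTopIII2015, Corollary 4.5 (iii) p.109] -/
theorem step_comp_of_level_pos {c a : V3.{u}} (r : Path c a) (p : Path a lvObs.{u}) (ha : a ≠ lvObs.{u})
    (hp : 0 < level p) :
    step Δ ι (r.comp p) = eqToHom (Δ.sub3.pathFunctor'_comp r p) ≫
      Functor.whiskerLeft (Δ.sub3.pathFunctor' r) (step Δ ι p) ≫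
      eqToHom (by rw [lower_comp_of_level_pos r p ha hp, DiagramOfCategories.pathFunctor'_comp]) :=
by
  rcases level_pos_cases p ha hp with ⟨p₀, rfl⟩ | ⟨n, p₂, rfl⟩
  · exact whiskerLeft_congr_left (Δ.sub3.pathFunctor'_comp r p₀) ι
  · exact whiskerLeft_congr_left (Δ.sub3.pathFunctor'_comp r p₂) Δ.ιlog

/-- `descend` of a pre-composed path is the whiskered `descend`. [cite: MochizukiAbsTopIII2015,
Corollary 4.5 (iii) p.109] -/
theorem descend_comp {c a : V3.{u}} (r : Path c a) (ha : a ≠ lvObs.{u}) :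
    ∀ (d : ℕ) (p : Path a lvObs.{u}) (hd : d ≤ level p),
      descend Δ ι d (r.comp p) = eqToHom (Δ.sub3.pathFunctor'_comp r p) ≫
        Functor.whiskerLeft (Δ.sub3.pathFunctor' r) (descend Δ ι d p) ≫
        eqToHom (by rw [iter_lower_comp r ha d p hd, DiagramOfCategories.pathFunctor'_comp])
  | 0, p, _ => by simp [descend_zero]
  | d + 1, p, hd => by
    have hp : 0 < level p := by omega
    have hd' : d ≤ level (lower p) := by rw [level_lower p ha]; omega
    rw [descend_succ, descend_succ, step_comp_of_level_pos Δ ι r p ha hp,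
      descend_congr Δ ι d (lower_comp_of_level_pos r p ha hp), descend_comp r ha d (lower p) hd']
    simp only [Category.assoc, eqToHom_trans, eqToHom_trans_assoc, eqToHom_refl, Category.id_comp]
    ext x
    simp only [NatTrans.comp_app, Functor.whiskerLeft_app, eqToHom_app]
    erw [Category.assoc]
    rfl

/-- Def. 3.5 (ii): the homotopies of `𝔖_log` are compatible with pre- and post-composition
(whiskering). [cite: MochizukiAbsTopIII2015, Corollary 4.5 (iii) p.109] -/
theorem sLogEta_whisker {a b c d : V3.{u}} {p q : Path a b} (h : SLogRel p q) (r₁ : Path c a)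
    (r₂ : Path b d) :
    sLogEta Δ ι (isSaturated_sLogRel.precomp (isSaturated_sLogRel.postcomp h r₂) r₁) =
      eqToHom (by rw [DiagramOfCategories.pathFunctor'_comp, DiagramOfCategories.pathFunctor'_comp])
≫
        Functor.whiskerLeft (Δ.sub3.pathFunctor' r₁)
          (Functor.whiskerRight (sLogEta Δ ι h) (Δ.sub3.pathFunctor' r₂)) ≫
        eqToHom (by rw [DiagramOfCategories.pathFunctor'_comp,
DiagramOfCategories.pathFunctor'_comp]) := by
  obtain ⟨hb, ha, hle⟩ := h
  subst hb
  obtain rfl := path_from_obs r₂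
  obtain rfl := path_obs_obs_eq_nil r₂
  have hd : level (r₁.comp (p.comp Path.nil)) - level (r₁.comp (q.comp Path.nil)) = level p - level q := by
    show level (r₁.comp p) - level (r₁.comp q) = _
    rw [level_comp r₁ p ha, level_comp r₁ q ha]; omega
  unfold sLogEta
  rw [descend_congr_nat Δ ι hd]
  rw [descend_comp Δ ι r₁ ha (level p - level q) (p.comp Path.nil) (by show _ ≤ level p; omega)]
  ext x
  simp only [NatTrans.comp_app, eqToHom_app, Functor.whiskerLeft_app, Functor.whiskerRight_app,
    DiagramOfCategories.pathFunctor'_nil, Functor.id_map, Category.assoc, eqToHom_trans]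
  erw [Category.assoc, eqToHom_trans]
  rfl

end Family

section Assembly

variable (Δ : LogFrobeniusData.{u}) (ι : Δ.lamPf ⟶ Δ.lamTimes)

/-- **The family of homotopies `𝔖_log`** on `𝒟_{≤3}` for input data of Aut-holomorphic type
(`ι_× = ι : λ^∼ → λ^×`): boundary set `SLogRel`, homotopies the alternating composites of `ι_×`,
`ι_log`
(proof of Cor. 4.5 (iii), pp. 109–110), transported to t2's `pathFunctor` by
`HomotopyFamily.mkOfStrict`.
[cite: MochizukiAbsTopIII2015, Corollary 4.5 (iii) p.109] -/
noncomputable def sLogFamily : Δ.sub3.HomotopyFamily :=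
  DiagramOfCategories.HomotopyFamily.mkOfStrict SLogRel isSaturated_sLogRel (fun _ _ _ _ h =>
sLogEta Δ ι h)
    (fun _ _ _ h => sLogEta_refl Δ ι h) (fun _ _ _ _ _ h₁ h₂ => sLogEta_trans Δ ι h₁ h₂)
    (fun _ _ _ _ _ _ h r₁ r₂ => sLogEta_whisker Δ ι h r₁ r₂)

/-- For data of Aut-holomorphic type the basic type-(4) pair starts with `[λ^∼]`. [cite:
MochizukiAbsTopIII2015, Corollary 4.5 (iii) p.109] -/
theorem timesPairLeft_eq (hι : Δ.ιtimes = Sum.inr ι) :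
    Δ.timesPairLeft = (Path.nil : Path lvNexus.{u} lvNexus).cons eLamPf := by
  unfold LogFrobeniusData.timesPairLeft; rw [hι]

/-- For data of Aut-holomorphic type the basic type-(4) pair ends with `[λ^×]`. [cite:
MochizukiAbsTopIII2015, Corollary 4.5 (iii) p.109] -/
theorem timesPairRight_eq (hι : Δ.ιtimes = Sum.inr ι) :
    Δ.timesPairRight = (Path.nil : Path lvNexus.{u} lvNexus).cons eLamTimes := by
  unfold LogFrobeniusData.timesPairRight; rw [hι]

/-- The basic type-(4) pair `([λ^∼], [λ^×])` precomposed: a generator of the saturation.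
[cite: MochizukiAbsTopIII2015, Corollary 4.5 (iii) p.109] -/
theorem sat_timesPair (hι : Δ.ιtimes = Sum.inr ι) {a : V3.{u}} (p₀ : Path a lvNexus.{u}) :
    Saturation Δ.LogGen (p₀.cons eLamPf) (p₀.cons eLamTimes) := by
  have h := Saturation.precomp p₀ (Saturation.base (LogFrobeniusData.LogGen.type2 (Δ := Δ)))
  rw [timesPairLeft_eq Δ ι hι, timesPairRight_eq Δ ι hι] at h
  exact h

/-- Every pair `(p, lower p)` with `p` not a bottom path is a precomposed generator.
[cite: MochizukiAbsTopIII2015, Corollary 4.5 (iii) p.109] -/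
theorem sat_lower (hι : Δ.ιtimes = Sum.inr ι) {a : V3.{u}} (p : Path a lvObs.{u}) (ha : a ≠ lvObs.{u})
    (hp : 0 < level p) : Saturation Δ.LogGen p (lower p) := by
  rcases level_pos_cases p ha hp with ⟨p₀, rfl⟩ | ⟨n, p₂, rfl⟩
  · exact sat_timesPair Δ ι hι p₀
  · exact Saturation.precomp p₂ (Saturation.base (LogFrobeniusData.LogGen.type1 (Δ := Δ) n))

/-- Every path into `𝒩` (from another vertex) occurs in the saturation, hence so does `(p, p)`.
[cite: MochizukiAbsTopIII2015, Corollary 4.5 (iii) p.109] -/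
theorem sat_refl (hι : Δ.ιtimes = Sum.inr ι) {a : V3.{u}} (p : Path a lvObs.{u}) (ha : a ≠ lvObs.{u}) :
    Saturation Δ.LogGen p p := by
  cases p with
  | nil => exact absurd rfl ha
  | cons p₀ e =>
    obtain rfl := eq_nexus_of_hom_obs e
    rcases hom_obs_eq e with rfl | rfl
    · exact (sat_timesPair Δ ι hι p₀).refl_right
    · exact (sat_timesPair Δ ι hι p₀).refl_left

/-- Every pair of `E_log` is obtained from the printed generators by saturation. [cite:
MochizukiAbsTopIII2015, Corollary 4.5 (iii) p.109] -/
theorem sat_of_sLogRel (hι : Δ.ιtimes = Sum.inr ι) {a : V3.{u}} (ha : a ≠ lvObs.{u}) :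
    ∀ (d : ℕ) (p q : Path a lvObs.{u}), level p = level q + d → Saturation Δ.LogGen p q
  | 0, p, q, h => by
    obtain rfl := obsPath_unique p q ha (by omega)
    exact sat_refl Δ ι hι p ha
  | d + 1, p, q, h => by
    have hp : 0 < level p := by omega
    have h1 : level (lower p) = level q + d := by rw [level_lower p ha]; omega
    exact (sat_lower Δ ι hι p ha hp).trans (sat_of_sLogRel hι ha d (lower p) q h1)

/-- **`E_log` is generated by the printed pairs** (Def. 3.5 (ii) "generated by"; t5's `LogGen`):
"if we take `E_log` to be the set of ordered pairs of paths on `Γ⃗_{𝒟≤3}` consisting of pairs of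
paths
of the above five types, then one verifies immediately that `E_log` satisfies the conditions … for a
saturated set" (p. 110). [cite: MochizukiAbsTopIII2015, Corollary 4.5 (iii) p.109] -/
theorem sLogRel_iff_saturation (hι : Δ.ιtimes = Sum.inr ι) {a b : V3.{u}} (p q : Path a b) :
    SLogRel p q ↔ Saturation Δ.LogGen p q := by
  constructor
  · rintro ⟨rfl, ha, hle⟩
    exact sat_of_sLogRel Δ ι hι ha (level p - level q) p q (by omega)
  · intro h
    induction h with
    | base hg =>
      cases hg with
      | type1 n => exact ⟨rfl, lvRow1_ne_lvObs _, by show 1 ≤ 2; omega⟩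
      | type2 =>
        rw [timesPairLeft_eq Δ ι hι, timesPairRight_eq Δ ι hι]
        exact ⟨rfl, lvNexus_ne_lvObs, by decide⟩
    | refl_left _ ih => exact isSaturated_sLogRel.refl_left ih
    | refl_right _ ih => exact isSaturated_sLogRel.refl_right ih
    | trans _ _ ih₁ ih₂ => exact isSaturated_sLogRel.trans ih₁ ih₂
    | precomp r _ ih => exact isSaturated_sLogRel.precomp ih r
    | postcomp r _ ih => exact isSaturated_sLogRel.postcomp ih r

/-- Computation rule for the homotopies of `sLogFamily`. [cite: MochizukiAbsTopIII2015, Corollary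
4.5 (iii) p.109] -/
theorem sLogFamily_η {a b : V3.{u}} {p q : Path a b} (h : SLogRel p q) :
    (sLogFamily Δ ι).η h = eqToHom (Δ.sub3.pathFunctor_eq_pathFunctor' p) ≫ sLogEta Δ ι h ≫
      eqToHom (Δ.sub3.pathFunctor_eq_pathFunctor' q).symm := rfl

/-- On the basic type-(4) pair the homotopy is `ι_×`. [cite: MochizukiAbsTopIII2015, Corollary 4.5
(iii) p.109] -/
theorem descend_timesPair :
    descend Δ ι (level ((Path.nil : Path lvNexus.{u} lvNexus).cons eLamPf) -
        level ((Path.nil : Path lvNexus.{u} lvNexus).cons eLamTimes))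
      ((Path.nil : Path lvNexus.{u} lvNexus).cons eLamPf) =
      Functor.whiskerLeft (𝟭 _) ι ≫ 𝟙 _ := rfl

/-- On the basic type-(1) pair the homotopy is `ι_log,⋎`. [cite: MochizukiAbsTopIII2015, Corollary
4.5 (iii) p.109] -/
theorem descend_logPair (n : ℤ) :
    descend Δ ι (level (logPairLeft.{u} n) - level (logPairRight.{u} n)) (logPairLeft.{u} n) =
      Functor.whiskerLeft (𝟭 _) Δ.ιlog ≫ 𝟙 _ := rfl

/-- **Cor. 4.5 (iii) over the abstract data**: for input data of Aut-holomorphic type, the printed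
natural transformations `ι_log,⋎`, `ι_×` generate a family of homotopies on `𝒟_{≤3}` determining an
observable `𝔖_log` on `𝒟_{≤2}` — t5's pinned `ObservableLogStmt` holds (family `sLogFamily`).
[cite: MochizukiAbsTopIII2015, Corollary 4.5 (iii) p.109] -/
theorem observableLogStmt_of_inr (hι : Δ.ιtimes = Sum.inr ι) : Δ.ObservableLogStmt := by
  refine ⟨sLogFamily Δ ι, fun a b p q => sLogRel_iff_saturation Δ ι hι p q, fun a b p q h => h.1,
?_⟩
  unfold LogFrobeniusData.LogPinned
  rw [hι]
  refine ⟨⟨⟨rfl, lvNexus_ne_lvObs, by decide⟩, fun x e₁ e₂ => ?_⟩,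
    fun n => ⟨⟨rfl, lvRow1_ne_lvObs _, by show 1 ≤ 2; omega⟩, fun x e₁ e₂ => ?_⟩⟩
  · rw [sLogFamily_η]
    unfold sLogEta
    rw [descend_timesPair]
    simp only [NatTrans.comp_app, eqToHom_app, Functor.whiskerLeft_app, Category.comp_id, Category.assoc,
      eqToHom_trans]
    rfl
  · rw [sLogFamily_η]
    unfold sLogEta
    rw [descend_logPair]
    simp only [NatTrans.comp_app, eqToHom_app, Functor.whiskerLeft_app, Category.comp_id, Category.assoc,
      eqToHom_trans]
    rfl

end Assembly
end Literature.AnabelianGeometry.AbsoluteAnabelian.AbsTopIII
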